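import Summits.ValiantsHypothesis.ValiantsHypothesis.Theorems.LacunarySymmetroidMatrixDescartesCensusDoorA34Coeffs
import Summits.ValiantsHypothesis.ValiantsHypothesis.Theorems.LacunarySymmetroidMatrixDescartesCensusFullAlternation
import Summits.ValiantsHypothesis.ValiantsHypothesis.Theorems.LacunarySymmetroidMatrixDescartesCensusDoorA34DefiniteLetter
import Mathlib.Analysis.Matrix.Spectrum

/-!
# `MatrixDescartes` census — DOOR A at `(3,4)`: the NINE-ROW LETTER INERTIA TABLE of a `(3,3)` source (all supports)

HONEST FRAMING.  Object-search cell `pub-symmetroid`, door-A seat `val-sym-door-p3` (g16); helper file beside the OPEN typed statement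
`DoorA34 = PosRootLawAt 3 4 18` (route item `Theses.LacunarySymmetroid.DoorA34`, stmt-ValiantsHypothesis-19980), asserted nowhere here.
The cell's only mechanism of record with ceiling `19` at `(3,4)` is the flag ladder over a `(3,3)` SOURCE ROW with NINE positive det-roots
whose exponent-`0` letter is DEFINITE (kernel: `Census.FlagInertia.no_flag_of_indefinite_letter`, `Census.flagLaw_no_five_one`); every paper
argument about such sources (seat reports G7 §5, G8 §3, G11 §3, G13 §2f, G15 §3) STARTS from the letter inertias that Descartes-sharpness
forces.  This file (part 1: support, dictionary, Descartes step, chamber walls) and its companion `…NineInertiaTable` (part 2: the sign and inertia tables) put that first step in the kernel, for every support: for a real `3 × 3` three-letter pencil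
`F = S 0 + X^(d 1) S 1 + X^(d 2) S 2` with `d 0 = 0 < d 1 < d 2`, `S 0 = 1` and NINE distinct positive det-roots,

* `support_eq_of_nine`, `sym_sum_injective_of_nine`: all TEN triple-sum monomials are present and the support is 3-Sidon
  (so `d 2 ∉ {3/2·d 1, 2·d 1, 3·d 1}`: `walls_of_nine`);
* the coefficient dictionary with `S 0 = 1` (`coeff_zero`, `coeff_d`, `coeff_two_d`, `coeff_cube`, `coeff_square`, `coeff_d1_add_d2`):
  `1, tr S₁, e₂ S₁, det S₁, tr S₂, e₂ S₂, det S₂, tr(adj S₁·S₂), tr(adj S₂·S₁)` and the polarised mixed coefficient;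
* (companion file `…CensusDoorA34NineInertiaTable`) THE TABLE (`signs_chamber_I/II/III/IV`): the signs of those nine coefficients are FORCED by the chamber of `d 2 / d 1` in
  `(3,∞) / (2,3) / (3/2,2) / (1,3/2)` (full alternation along the chamber's exponent order, `Census.coeff_mul_coeff_neg_of_sharp`);
* THE INERTIAS (`inertia_chamber_I/II/III/IV`, symmetric letters): chamber I `−S₁ ≻ 0`, `S₂` of inertia `(2,1)`; chamber II `S₁` of
  inertia `(1,2)`, `S₂` `(2,1)` with `tr S₂ < 0`; chamber III both `(2,1)` with `tr S₁ < 0 < tr S₂`; chamber IV `S₁` `(1,2)`, `S₂` `(2,1)` —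
  inertia `(2,1)` being typed as `det < 0 ∧ ¬(−S) ≻ 0` and `(1,2)` as `0 < det ∧ ¬ S ≻ 0` (for `3 × 3` these ARE the index statements),
  via the elementary `posDef_of_invariants_pos` (`e₁,e₂,e₃ > 0 ⇒ ≻ 0`, spectral theorem) and `PosDef.trace_pos` on `S` / `adj S`.

This is the g8 «inertia table by κ-range» (report FLAG-MULTISCALE-CLAIML §3) as a theorem.  The normalisation `S 0 = 1` is the congruence
gauge of a positive definite bottom letter (a general `S 0 ≻ 0` is `YᵀY`; congruence preserves det-roots and inertias) — the transfer is NOT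
typed here.  Nothing here bounds `ζ_sym(3,3)` or `ζ_sym(3,4)`; `DoorA34`, Claim L («no pure-λ_min nine») and `MatrixDescartes`
(stmt-ValiantsHypothesis-18050) stay OPEN; nothing on `VP ≠ VNP`.
[folklore] Descartes' rule of signs (sharp case), Leibniz expansion, the spectral theorem for real symmetric matrices; elementary.
-/

open Polynomial Finset Matrix

-- `Summit.ValiantsHypothesis.ValiantsHypothesis.…` repeats a component by the D-0017 layout
-- (single-conjunct summit), which the `dupNamespace` linter flags; the name is mandated.
set_option linter.dupNamespace false

namespace Summit.ValiantsHypothesis.ValiantsHypothesis.Theorems.LacunarySymmetroidMatrixDescartes.Census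

namespace NineInertia

open scoped BigOperators Polynomial Matrix

/-! ## 1. Nine positive roots force all ten monomials (`K = 3` twin of `…DoorA34Letters`) -/

/-- Nine positive roots ⇒ the determinant is not the zero polynomial. [folklore] -/
theorem det_pencil_ne_zero_of_nine (d : Fin 3 → ℕ) (S : Fin 3 → Matrix (Fin 3) (Fin 3) ℝ)
    (h9 : 9 ≤ ((Matrix.det (∑ l, ((X : ℝ[X]) ^ d l) • (S l).map C)).roots.toFinset.filter (fun t => 0 < t)).card) :
    Matrix.det (∑ l, ((X : ℝ[X]) ^ d l) • (S l).map C) ≠ 0 := by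
  intro h
  rw [h, Polynomial.roots_zero, Multiset.toFinset_zero, Finset.filter_empty, Finset.card_empty] at h9
  omega

/-- **Nine positive roots force all ten monomials**: the support of the determinant of a three-term `3 × 3` pencil with nine distinct
positive roots is the whole image of `Sym (Fin 3) 3` under `s ↦ ∑_{l ∈ s} d l` (sparse Descartes: `9 < #support ≤ 10`). [folklore] -/
theorem support_eq_of_nine (d : Fin 3 → ℕ) (S : Fin 3 → Matrix (Fin 3) (Fin 3) ℝ)
    (h9 : 9 ≤ ((Matrix.det (∑ l, ((X : ℝ[X]) ^ d l) • (S l).map C)).roots.toFinset.filter (fun t => 0 < t)).card) :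
    (Matrix.det (∑ l, ((X : ℝ[X]) ^ d l) • (S l).map C)).support
      = (Finset.univ : Finset (Sym (Fin 3) 3)).image (fun s : Sym (Fin 3) 3 => ((s : Multiset (Fin 3)).map d).sum) := by
  have hP := det_pencil_ne_zero_of_nine d S h9
  have hlt := Literature.Computability.AlgebraicComplexity.card_roots_toFinset_filter_pos_lt_card_support hP
  have hsub := StubDescartesCeiling.support_det_pencil_subset d S
  have hcard : ((Finset.univ : Finset (Sym (Fin 3) 3)).image
      (fun s : Sym (Fin 3) 3 => ((s : Multiset (Fin 3)).map d).sum)).card ≤ 10 :=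
    Finset.card_image_le.trans (by rw [Finset.card_univ, Sym.card_sym_eq_choose]; decide)
  exact Finset.eq_of_subset_of_card_le hsub (by omega)

/-- The sharpness inequality in the form `Census.coeff_mul_coeff_neg_of_sharp` wants: `#support ≤ Z₊ + 1`. [folklore] -/
theorem card_support_le_of_nine (d : Fin 3 → ℕ) (S : Fin 3 → Matrix (Fin 3) (Fin 3) ℝ)
    (h9 : 9 ≤ ((Matrix.det (∑ l, ((X : ℝ[X]) ^ d l) • (S l).map C)).roots.toFinset.filter (fun t => 0 < t)).card) :
    (Matrix.det (∑ l, ((X : ℝ[X]) ^ d l) • (S l).map C)).support.card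
      ≤ ((Matrix.det (∑ l, ((X : ℝ[X]) ^ d l) • (S l).map C)).roots.toFinset.filter (fun t => 0 < t)).card + 1 := by
  have h := StubDescartesCeiling.card_support_det_pencil_le d S
  have h10 : Nat.choose (3 + 3 - 1) 3 = 10 := by decide
  omega

/-- With nine positive roots the ten multiset sums are pairwise distinct (the support is 3-Sidon). [folklore] -/
theorem sym_sum_injective_of_nine (d : Fin 3 → ℕ) (S : Fin 3 → Matrix (Fin 3) (Fin 3) ℝ)
    (h9 : 9 ≤ ((Matrix.det (∑ l, ((X : ℝ[X]) ^ d l) • (S l).map C)).roots.toFinset.filter (fun t => 0 < t)).card) :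
    Function.Injective (fun s : Sym (Fin 3) 3 => ((s : Multiset (Fin 3)).map d).sum) := by
  have hP := det_pencil_ne_zero_of_nine d S h9
  have hlt := Literature.Computability.AlgebraicComplexity.card_roots_toFinset_filter_pos_lt_card_support hP
  have heq := support_eq_of_nine d S h9
  have h10 : (Finset.univ : Finset (Sym (Fin 3) 3)).card = 10 := by
    rw [Finset.card_univ, Sym.card_sym_eq_choose]; decide
  have hinj : Set.InjOn (fun s : Sym (Fin 3) 3 => ((s : Multiset (Fin 3)).map d).sum) ↑(Finset.univ : Finset (Sym (Fin 3) 3)) := by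
    rw [← Finset.card_image_iff]
    refine le_antisymm Finset.card_image_le ?_
    rw [← heq, h10]
    omega
  intro s₁ s₂ h
  exact hinj (Finset.mem_coe.2 (Finset.mem_univ _)) (Finset.mem_coe.2 (Finset.mem_univ _)) h

/-- Every triple sum `d a + d b + d c` is a monomial of a nine-row. [folklore] -/
theorem mem_support_of_nine (d : Fin 3 → ℕ) (S : Fin 3 → Matrix (Fin 3) (Fin 3) ℝ)
    (h9 : 9 ≤ ((Matrix.det (∑ l, ((X : ℝ[X]) ^ d l) • (S l).map C)).roots.toFinset.filter (fun t => 0 < t)).card)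
    (a b c : Fin 3) : d a + d b + d c ∈ (Matrix.det (∑ l, ((X : ℝ[X]) ^ d l) • (S l).map C)).support := by
  rw [support_eq_of_nine d S h9]
  refine Finset.mem_image.mpr ⟨⟨Finset.univ.val.map (![a, b, c] : Fin 3 → Fin 3), StubDescartesCeiling.card_map_univ_val _⟩,
    Finset.mem_univ _, ?_⟩
  change ((Finset.univ.val.map (![a, b, c] : Fin 3 → Fin 3)).map d).sum = d a + d b + d c
  rw [← StubDescartesCeiling.sum_eq_sym_sum]
  simp [Fin.sum_univ_three]

/-- Conversely every monomial of the determinant is a triple sum (no sharpness needed). [folklore] -/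
theorem mem_support_cases (d : Fin 3 → ℕ) (S : Fin 3 → Matrix (Fin 3) (Fin 3) ℝ) {c : ℕ}
    (hc : c ∈ (Matrix.det (∑ l, ((X : ℝ[X]) ^ d l) • (S l).map C)).support) :
    ∃ p : Fin 3 × Fin 3 × Fin 3, c = d p.1 + d p.2.1 + d p.2.2 := by
  have h := support_det_pencil_subset_sumset d S hc
  rw [sumset_three_eq_tripleSums] at h
  obtain ⟨p, -, hp⟩ := Finset.mem_image.mp h
  exact ⟨p, hp.symm⟩

/-- Two sums `∑ t, d (f t)`, `∑ t, d (g t)` agree iff the `Sym`-sums of the value multisets agree (bookkeeping). [folklore] -/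
theorem univ_val_map_eq_of_sum_eq (d : Fin 3 → ℕ) (S : Fin 3 → Matrix (Fin 3) (Fin 3) ℝ)
    (h9 : 9 ≤ ((Matrix.det (∑ l, ((X : ℝ[X]) ^ d l) • (S l).map C)).roots.toFinset.filter (fun t => 0 < t)).card)
    (f g : Fin 3 → Fin 3) (h : (∑ t, d (f t)) = ∑ t, d (g t)) :
    Finset.univ.val.map f = Finset.univ.val.map g := by
  have hinj := sym_sum_injective_of_nine d S h9
  have hsum : (((⟨Finset.univ.val.map f, StubDescartesCeiling.card_map_univ_val f⟩ : Sym (Fin 3) 3) : Multiset (Fin 3)).map d).sum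
      = (((⟨Finset.univ.val.map g, StubDescartesCeiling.card_map_univ_val g⟩ : Sym (Fin 3) 3) : Multiset (Fin 3)).map d).sum := by
    change ((Finset.univ.val.map f).map d).sum = ((Finset.univ.val.map g).map d).sum
    rw [← StubDescartesCeiling.sum_eq_sym_sum, ← StubDescartesCeiling.sum_eq_sym_sum, h]
  exact congrArg (fun s : Sym (Fin 3) 3 => (s : Multiset (Fin 3))) (hinj hsum)

/-- Finite bookkeeping: a map `f : Fin 3 → Fin 3` with value multiset `{l,l,l}` is constant. [folklore] -/
theorem fin3_of_univ_val_map_eq_cube (l : Fin 3) (f : Fin 3 → Fin 3)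
    (h : Finset.univ.val.map f = Finset.univ.val.map (![l, l, l] : Fin 3 → Fin 3)) : ∀ i, f i = l := by
  revert l f; decide

/-- Finite bookkeeping: a map `f : Fin 3 → Fin 3` with value multiset `{i,i,k}` (`i ≠ k`) is one of the three arrangements. [folklore] -/
theorem fin3_of_univ_val_map_eq_square (i k : Fin 3) (hik : i ≠ k) (f : Fin 3 → Fin 3)
    (h : Finset.univ.val.map f = Finset.univ.val.map (![i, i, k] : Fin 3 → Fin 3)) :
    f = ![i, i, k] ∨ f = ![i, k, i] ∨ f = ![k, i, i] := by
  revert i k hik f; decide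

/-- Finite bookkeeping: a map `f : Fin 3 → Fin 3` with value multiset `{i,j,k}` (pairwise distinct) is one of the six arrangements.
[folklore] -/
theorem fin3_of_univ_val_map_eq_mixed (i j k : Fin 3) (hij : i ≠ j) (hik : i ≠ k) (hjk : j ≠ k) (f : Fin 3 → Fin 3)
    (h : Finset.univ.val.map f = Finset.univ.val.map (![i, j, k] : Fin 3 → Fin 3)) :
    f = ![i, j, k] ∨ f = ![i, k, j] ∨ f = ![j, i, k] ∨ f = ![j, k, i] ∨ f = ![k, i, j] ∨ f = ![k, j, i] := by
  revert f
  fin_cases i <;> fin_cases j <;> fin_cases k <;> simp_all <;> decide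

/-- Nine roots ⇒ the cube exponent `3·d l` is represented only by the constant map. [folklore] -/
theorem cube_unique_of_nine (d : Fin 3 → ℕ) (S : Fin 3 → Matrix (Fin 3) (Fin 3) ℝ)
    (h9 : 9 ≤ ((Matrix.det (∑ l, ((X : ℝ[X]) ^ d l) • (S l).map C)).roots.toFinset.filter (fun t => 0 < t)).card)
    (l : Fin 3) : ∀ f : Fin 3 → Fin 3, (∑ t, d (f t)) = 3 * d l → ∀ i, f i = l := by
  intro f hf
  have hg : (∑ t, d ((![l, l, l] : Fin 3 → Fin 3) t)) = 3 * d l := by simp [Fin.sum_univ_three]; ring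
  exact fin3_of_univ_val_map_eq_cube l f (univ_val_map_eq_of_sum_eq d S h9 f _ (hf.trans hg.symm))

/-- Nine roots ⇒ the square exponent `2·d i + d k` (`i ≠ k`) is represented only by the arrangements of `{i,i,k}`. [folklore] -/
theorem square_unique_of_nine (d : Fin 3 → ℕ) (S : Fin 3 → Matrix (Fin 3) (Fin 3) ℝ)
    (h9 : 9 ≤ ((Matrix.det (∑ l, ((X : ℝ[X]) ^ d l) • (S l).map C)).roots.toFinset.filter (fun t => 0 < t)).card)
    {i k : Fin 3} (hik : i ≠ k) :
    ∀ f : Fin 3 → Fin 3, (∑ t, d (f t)) = 2 * d i + d k → f = ![i, i, k] ∨ f = ![i, k, i] ∨ f = ![k, i, i] := by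
  intro f hf
  have hg : (∑ t, d ((![i, i, k] : Fin 3 → Fin 3) t)) = 2 * d i + d k := by simp [Fin.sum_univ_three]; ring
  exact fin3_of_univ_val_map_eq_square i k hik f (univ_val_map_eq_of_sum_eq d S h9 f _ (hf.trans hg.symm))

/-- Nine roots ⇒ the mixed exponent `d i + d j + d k` (pairwise distinct letters) is represented only by the six arrangements. [folklore] -/
theorem mixed_unique_of_nine (d : Fin 3 → ℕ) (S : Fin 3 → Matrix (Fin 3) (Fin 3) ℝ)
    (h9 : 9 ≤ ((Matrix.det (∑ l, ((X : ℝ[X]) ^ d l) • (S l).map C)).roots.toFinset.filter (fun t => 0 < t)).card)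
    {i j k : Fin 3} (hij : i ≠ j) (hik : i ≠ k) (hjk : j ≠ k) :
    ∀ f : Fin 3 → Fin 3, (∑ t, d (f t)) = d i + d j + d k →
      f = ![i, j, k] ∨ f = ![i, k, j] ∨ f = ![j, i, k] ∨ f = ![j, k, i] ∨ f = ![k, i, j] ∨ f = ![k, j, i] := by
  intro f hf
  have hg : (∑ t, d ((![i, j, k] : Fin 3 → Fin 3) t)) = d i + d j + d k := by simp [Fin.sum_univ_three]
  exact fin3_of_univ_val_map_eq_mixed i j k hij hik hjk f (univ_val_map_eq_of_sum_eq d S h9 f _ (hf.trans hg.symm))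

/-! ## 2. The coefficient dictionary of a nine-row with `S 0 = 1` -/

/-- **The cube letter of the dictionary** (any number of letters): if `3·d l` is represented only by the constant map, the coefficient
of `X^(3·d l)` is `det (S l)` (`K`-letter twin of `Census.coeff_det_pencil_three_mul`). [folklore] -/
theorem coeff_det_pencil_three_cube {K : ℕ} (d : Fin K → ℕ) (S : Fin K → Matrix (Fin 3) (Fin 3) ℝ) (l : Fin K)
    (h3 : ∀ f : Fin 3 → Fin K, (∑ i, d (f i)) = 3 * d l → ∀ i, f i = l) :
    (Matrix.det (∑ k, ((X : ℝ[X]) ^ d k) • (S k).map C)).coeff (3 * d l) = (S l).det := by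
  rw [coeff_det_pencil, Matrix.det_apply']
  refine Finset.sum_congr rfl fun σ _ => ?_
  rw [Finset.sum_eq_single (fun _ => l)]
  · have hs : (∑ _i : Fin 3, d l) = 3 * d l := by simp [Finset.sum_const]
    simp only [hs, if_true]
  · intro f _ hf
    rw [if_neg]
    intro h
    exact hf (funext fun i => h3 f h.symm i)
  · intro h
    exact absurd (Finset.mem_univ _) h

section Dictionary

variable (d : Fin 3 → ℕ) (S : Fin 3 → Matrix (Fin 3) (Fin 3) ℝ)
  (h9 : 9 ≤ ((Matrix.det (∑ l, ((X : ℝ[X]) ^ d l) • (S l).map C)).roots.toFinset.filter (fun t => 0 < t)).card)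
  (h0 : d 0 = 0) (hS0 : S 0 = 1)
include h9

/-- `coeff (3·d l) = det (S l)` for every letter of a nine-row. [folklore] -/
theorem coeff_cube (l : Fin 3) : (Matrix.det (∑ k, ((X : ℝ[X]) ^ d k) • (S k).map C)).coeff (3 * d l) = (S l).det :=
  coeff_det_pencil_three_cube d S l (cube_unique_of_nine d S h9 l)

/-- `coeff (2·d i + d k) = tr(adj (S i) · S k)` for `i ≠ k`. [folklore] -/
theorem coeff_square {i k : Fin 3} (hik : i ≠ k) :
    (Matrix.det (∑ l, ((X : ℝ[X]) ^ d l) • (S l).map C)).coeff (2 * d i + d k) = ((S i).adjugate * S k).trace :=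
  coeff_det_pencil_three_square d S hik (square_unique_of_nine d S h9 hik)

/-- `coeff (d 0 + d 1 + d 2)` is the polarised mixed determinant `tr((adj(S 0 + S 1) − adj(S 0) − adj(S 1)) · S 2)`. [folklore] -/
theorem coeff_mixed :
    (Matrix.det (∑ l, ((X : ℝ[X]) ^ d l) • (S l).map C)).coeff (d 0 + d 1 + d 2)
      = (((S 0 + S 1).adjugate - (S 0).adjugate - (S 1).adjugate) * S 2).trace :=
  coeff_det_pencil_three_mixed d S (i := 0) (j := 1) (k := 2) (by decide) (by decide) (by decide)
    (mixed_unique_of_nine d S h9 (by decide) (by decide) (by decide))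

include h0 hS0

/-- With `d 0 = 0`, `S 0 = 1`: the constant coefficient is `det 1 = 1`. [folklore] -/
theorem coeff_zero : (Matrix.det (∑ l, ((X : ℝ[X]) ^ d l) • (S l).map C)).coeff 0 = 1 := by
  have h := coeff_cube d S h9 0
  rw [h0, mul_zero, hS0, Matrix.det_one] at h
  exact h

/-- `coeff (d k) = tr (S k)` for `k ≠ 0` (`2·d 0 + d k = d k`, `adj 1 = 1`). [folklore] -/
theorem coeff_d {k : Fin 3} (hk : k ≠ 0) : (Matrix.det (∑ l, ((X : ℝ[X]) ^ d l) • (S l).map C)).coeff (d k) = (S k).trace := by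
  have h := coeff_square d S h9 (i := 0) (k := k) hk.symm
  rw [h0, mul_zero, zero_add, hS0, Matrix.adjugate_one, Matrix.one_mul] at h
  exact h

/-- `coeff (2·d k) = tr adj (S k) = e₂ (S k)` for `k ≠ 0`. [folklore] -/
theorem coeff_two_d {k : Fin 3} (hk : k ≠ 0) :
    (Matrix.det (∑ l, ((X : ℝ[X]) ^ d l) • (S l).map C)).coeff (2 * d k) = (S k).adjugate.trace := by
  have h := coeff_square d S h9 (i := k) (k := 0) hk
  rw [h0, add_zero, hS0, Matrix.mul_one] at h
  exact h

/-- `coeff (d 1 + d 2) = tr((adj(1 + S 1) − 1 − adj(S 1)) · S 2)` (the polarised mixed coefficient at the bottom letter `1`). [folklore] -/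
theorem coeff_d1_add_d2 :
    (Matrix.det (∑ l, ((X : ℝ[X]) ^ d l) • (S l).map C)).coeff (d 1 + d 2)
      = (((1 + S 1).adjugate - 1 - (S 1).adjugate) * S 2).trace := by
  have h := coeff_mixed d S h9
  rw [h0, zero_add, hS0, Matrix.adjugate_one] at h
  exact h

end Dictionary

/-! ## 3. Exponent bookkeeping: the ten triple sums of `(0, d 1, d 2)` -/

/-- With `d 0 = 0`, every monomial exponent of the three-letter `3 × 3` pencil determinant is one of the ten triple sums
`0, d₁, 2d₁, 3d₁, d₂, d₁+d₂, 2d₁+d₂, 2d₂, 2d₂+d₁, 3d₂` (no sharpness needed). [folklore] -/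
theorem exponent_cases (d : Fin 3 → ℕ) (S : Fin 3 → Matrix (Fin 3) (Fin 3) ℝ) (h0 : d 0 = 0) {c : ℕ}
    (hc : c ∈ (Matrix.det (∑ l, ((X : ℝ[X]) ^ d l) • (S l).map C)).support) :
    c = 0 ∨ c = d 1 ∨ c = 2 * d 1 ∨ c = 3 * d 1 ∨ c = d 2 ∨ c = d 1 + d 2 ∨ c = 2 * d 1 + d 2 ∨ c = 2 * d 2 ∨
      c = 2 * d 2 + d 1 ∨ c = 3 * d 2 := by
  obtain ⟨⟨p1, p2, p3⟩, rfl⟩ := mem_support_cases d S hc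
  fin_cases p1 <;> fin_cases p2 <;> fin_cases p3 <;> simp [h0] <;> omega

section Signs

variable (d : Fin 3 → ℕ) (S : Fin 3 → Matrix (Fin 3) (Fin 3) ℝ)
  (h9 : 9 ≤ ((Matrix.det (∑ l, ((X : ℝ[X]) ^ d l) • (S l).map C)).roots.toFinset.filter (fun t => 0 < t)).card)
  (h0 : d 0 = 0) (hS0 : S 0 = 1)
include h9

/-- **One Descartes step**: for two monomials `x < y` of a nine-row with no monomial strictly between them, the coefficients have
opposite signs (`Census.coeff_mul_coeff_neg_of_sharp`). [folklore] -/
theorem sign_step {x y : ℕ} (hx : x ∈ (Matrix.det (∑ l, ((X : ℝ[X]) ^ d l) • (S l).map C)).support)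
    (hy : y ∈ (Matrix.det (∑ l, ((X : ℝ[X]) ^ d l) • (S l).map C)).support) (hxy : x < y)
    (hgap : ∀ c ∈ (Matrix.det (∑ l, ((X : ℝ[X]) ^ d l) • (S l).map C)).support, c ≤ x ∨ y ≤ c) :
    (Matrix.det (∑ l, ((X : ℝ[X]) ^ d l) • (S l).map C)).coeff x
      * (Matrix.det (∑ l, ((X : ℝ[X]) ^ d l) • (S l).map C)).coeff y < 0 :=
  coeff_mul_coeff_neg_of_sharp _ (card_support_le_of_nine d S h9) hx hy hxy
    (fun c hc h => by rcases hgap c hc with h' | h' <;> omega)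

include h0

/-- The ten monomials of a nine-row with `d 0 = 0`, in the syntactic forms the dictionary uses. [folklore] -/
theorem mem_support_ten :
    (0 : ℕ) ∈ (Matrix.det (∑ l, ((X : ℝ[X]) ^ d l) • (S l).map C)).support ∧
    d 1 ∈ (Matrix.det (∑ l, ((X : ℝ[X]) ^ d l) • (S l).map C)).support ∧
    2 * d 1 ∈ (Matrix.det (∑ l, ((X : ℝ[X]) ^ d l) • (S l).map C)).support ∧
    3 * d 1 ∈ (Matrix.det (∑ l, ((X : ℝ[X]) ^ d l) • (S l).map C)).support ∧
    d 2 ∈ (Matrix.det (∑ l, ((X : ℝ[X]) ^ d l) • (S l).map C)).support ∧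
    d 1 + d 2 ∈ (Matrix.det (∑ l, ((X : ℝ[X]) ^ d l) • (S l).map C)).support ∧
    2 * d 1 + d 2 ∈ (Matrix.det (∑ l, ((X : ℝ[X]) ^ d l) • (S l).map C)).support ∧
    2 * d 2 ∈ (Matrix.det (∑ l, ((X : ℝ[X]) ^ d l) • (S l).map C)).support ∧
    2 * d 2 + d 1 ∈ (Matrix.det (∑ l, ((X : ℝ[X]) ^ d l) • (S l).map C)).support ∧
    3 * d 2 ∈ (Matrix.det (∑ l, ((X : ℝ[X]) ^ d l) • (S l).map C)).support := by
  have m := mem_support_of_nine d S h9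
  refine ⟨?_, ?_, ?_, ?_, ?_, ?_, ?_, ?_, ?_, ?_⟩
  · have h := m 0 0 0; rwa [h0] at h
  · have h := m 0 0 1; rwa [h0, zero_add, zero_add] at h
  · have h := m 0 1 1; rwa [h0, zero_add, ← two_mul] at h
  · have h := m 1 1 1; rwa [show d 1 + d 1 + d 1 = 3 * d 1 by ring] at h
  · have h := m 0 0 2; rwa [h0, zero_add, zero_add] at h
  · have h := m 0 1 2; rwa [h0, zero_add] at h
  · have h := m 1 1 2; rwa [← two_mul] at h
  · have h := m 0 2 2; rwa [h0, zero_add, ← two_mul] at h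
  · have h := m 2 2 1; rwa [← two_mul] at h
  · have h := m 2 2 2; rwa [show d 2 + d 2 + d 2 = 3 * d 2 by ring] at h


/-- **The chamber walls carry no nine-row**: nine positive roots force `3d₁ ≠ d₂`, `2d₁ ≠ d₂`, `2d₂ ≠ 3d₁` (a coincidence of triple sums
leaves `≤ 9` monomials). [folklore] -/
theorem walls_of_nine : 3 * d 1 ≠ d 2 ∧ 2 * d 1 ≠ d 2 ∧ 2 * d 2 ≠ 3 * d 1 := by
  have hinj := sym_sum_injective_of_nine d S h9
  have key : ∀ f g : Fin 3 → Fin 3, (∑ t, d (f t)) = (∑ t, d (g t)) → Finset.univ.val.map f = Finset.univ.val.map g :=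
    fun f g h => univ_val_map_eq_of_sum_eq d S h9 f g h
  refine ⟨fun h => ?_, fun h => ?_, fun h => ?_⟩
  · have e := key ![1, 1, 1] ![0, 0, 2] (by simp [Fin.sum_univ_three, h0]; omega)
    exact absurd e (by decide)
  · have e := key ![0, 1, 1] ![0, 0, 2] (by simp [Fin.sum_univ_three, h0]; omega)
    exact absurd e (by decide)
  · have e := key ![0, 2, 2] ![1, 1, 1] (by simp [Fin.sum_univ_three, h0]; omega)
    exact absurd e (by decide)


end Signs

end NineInertia

end Summit.ValiantsHypothesis.ValiantsHypothesis.Theorems.LacunarySymmetroidMatrixDescartes.Census
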